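import Summits.QuantumFields.YangMills.Theorems.IsotropyFromPowerCountingTemperedCurvatureMomentsDegreeTwo
import Summits.QuantumFields.YangMills.Theorems.IsotropyFromPowerCountingTemperedCurvatureMomentsDominated
import Summits.QuantumFields.YangMills.Theorems.IsotropyFromPowerCountingTemperedCurvatureMomentsFrequentlyTame
import Summits.QuantumFields.YangMills.Theorems.IsotropyFromPowerCountingTemperedCurvatureMomentsBddRenormalisationOrderZero

/-!
# `TemperedCurvatureMoments` — the residual of the crux is degrees `n ≥ 3` on eventually-wild schemes

Support file for the item `IsotropyFromPowerCounting.TemperedCurvatureMoments` (T, stmt-QuantumFields-17721), line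
`Sketch`, lead c2 (reshape 3).  Degrees 1 and 2 of T are THEOREMS for every admissible family:

* degree 1 along every tied scheme (`DegreeOne.temperedCurvatureMoments_one`, p140708);
* degree 2 MODEL-BLINDLY (`stub_degreeTwo`, p168473: OS package, translations, proper signed permutations, the
  eight planar frames and realness, via the sixteen-mirror kernel lever `CurvatureKernel.KernelOffDiagonal` of crux
  11687's line and domination).

Hence (`temperedApproximants_of_lt_three`) the low degrees of T hold outright, and the crux BY NAME is equivalent to
its restriction to degrees `n ≥ 3` (`temperedCurvatureMoments_iff_threeLe`), to degrees `n ≥ 3` on EVENTUALLY-WILD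
schemes (`β_k ≠ 0` eventually and `|c_k| → ∞`; `temperedCurvatureMoments_iff_threeLe_eventuallyWild`, combining with
lead c1's sector split), and to ORDER-ZERO temperedness of `𝔖ₙ|⁰𝒮` in degrees `n ≥ 3` only
(`temperedCurvatureMoments_iff_threeLe_dominated`).  This is the exact residual of line `Sketch` after reshape 3
(its one open stub `stub_shieldedMomentBoundSubseqHigh` is CH_n along a subsequence for `n ≥ 3`).

References: Osterwalder–Schrader 1973 §2, 1975 §2 (`⁰𝒮`); Glimm–Jaffe 1987 §6.1, §19.
-/

noncomputable section

namespace Summit.QuantumFields.YangMills.Theorems.TemperedCurvatureMoments.Sketch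

open scoped BigOperators SchwartzMap
open MeasureTheory Filter Topology
open Literature.MathematicalPhysics.QuantumFieldTheory Literature.MathematicalPhysics.QuantumLattice
open Literature.MathematicalPhysics.AQFT
open Literature.Probability.LatticeModels (box Site)
open Summit.QuantumFields.YangMills.Theorems.CurvatureBoostCovariance.Negative (Tie W1 EightFrameRP PlanarCone)
open Summit.QuantumFields.YangMills.Theorems.NPointIsotropy.Negative (E4)
open Summit.QuantumFields.YangMills.Theses.IsotropyFromPowerCounting (TemperedCurvatureMoments)
open Summit.QuantumFields.YangMills.Theorems.TemperedCurvatureMoments.Negative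
open Summit.QuantumFields.YangMills.Theorems.SoftKernelBoostCovariance.Sketch (DegreeOne.temperedCurvatureMoments_one)

variable {G : Type} [Group G] [TopologicalSpace G] [IsTopologicalGroup G] [CompactSpace G]
  [MeasurableSpace G] [BorelSpace G]

/-- **Degrees `1` and `2` of T hold outright** for every admissible family: degree 1 by
`DegreeOne.temperedCurvatureMoments_one` (every tied scheme), degree 2 by the model-blind `stub_degreeTwo`
(realness of `S₁ 2` on real off-diagonal tensors from the tie). [folklore] -/
theorem temperedApproximants_of_lt_three (hG : IsCompactSimpleLieGroup G) (r : LatticeRep G)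
    (sch : SpeciesScheme (YMSpecies G)) (S₁ : SchwingerFamily E4) (hW : W1 r sch S₁) (h8 : EightFrameRP S₁)
    (hC : PlanarCone S₁) {n : ℕ} (hn : 0 < n) (hn3 : n < 3) : TemperedApproximants sch.a sch.L S₁ n := by
  interval_cases n
  · exact DegreeOne.temperedCurvatureMoments_one G hG r sch S₁ hW h8 hC
  · exact stub_degreeTwo S₁ hW.2.1 hW.2.2.1 hW.2.2.2.1 h8
      (fun f F hF hF' => im_apply_eq_zero_of_tie r sch S₁ hW.1 two_pos f F hF hF')
      sch.a sch.L sch.a_pos sch.tendsto_a sch.tendsto_L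

/-- **T ⟺ T in degrees `n ≥ 3`.**  `TemperedCurvatureMoments` BY NAME is equivalent to its restriction to degrees
`3 ≤ n` (degrees 1, 2 by `temperedApproximants_of_lt_three`). [folklore] -/
theorem temperedCurvatureMoments_iff_threeLe :
    TemperedCurvatureMoments ↔
      ∀ (G : Type) [Group G] [TopologicalSpace G] [IsTopologicalGroup G] [CompactSpace G]
        [MeasurableSpace G] [BorelSpace G], IsCompactSimpleLieGroup G →
        ∀ (r : LatticeRep G) (sch : SpeciesScheme (YMSpecies G)) (S₁ : SchwingerFamily E4),
          W1 r sch S₁ → EightFrameRP S₁ → PlanarCone S₁ →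
          ∀ n : ℕ, 3 ≤ n → TemperedApproximants sch.a sch.L S₁ n := by
  rw [temperedCurvatureMoments_iff]
  constructor
  · intro h G _ _ _ _ _ _ hG r sch S₁ hW h8 hC n hn
    exact h G hG r sch S₁ hW h8 hC n (by omega)
  · intro h G _ _ _ _ _ _ hG r sch S₁ hW h8 hC n hn
    rcases Nat.lt_or_ge n 3 with hlt | hge
    · exact temperedApproximants_of_lt_three hG r sch S₁ hW h8 hC hn hlt
    · exact h G hG r sch S₁ hW h8 hC n hge

/-- **T ⟺ T in degrees `n ≥ 3` on the EVENTUALLY-WILD sector.**  `TemperedCurvatureMoments` BY NAME is equivalent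
to: for every admissible `(G, r, sch, S₁)` whose scheme has `β_k ≠ 0` eventually and `|c_k| → ∞`, and every `n ≥ 3`,
`TemperedApproximants sch.a sch.L S₁ n` (lead c1's `temperedCurvatureMoments_iff_eventuallyWildSector` restricted
to the high degrees). [folklore] -/
theorem temperedCurvatureMoments_iff_threeLe_eventuallyWild :
    TemperedCurvatureMoments ↔
      ∀ (G : Type) [Group G] [TopologicalSpace G] [IsTopologicalGroup G] [CompactSpace G]
        [MeasurableSpace G] [BorelSpace G], IsCompactSimpleLieGroup G →
        ∀ (r : LatticeRep G) (sch : SpeciesScheme (YMSpecies G)) (S₁ : SchwingerFamily E4),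
          W1 r sch S₁ → EightFrameRP S₁ → PlanarCone S₁ →
          (∀ᶠ k in atTop, sch.β k ≠ 0) → Tendsto (fun k => |sch.c r.curvature k|) atTop atTop →
          ∀ n : ℕ, 3 ≤ n → TemperedApproximants sch.a sch.L S₁ n := by
  rw [temperedCurvatureMoments_iff_eventuallyWildSector]
  constructor
  · intro h G _ _ _ _ _ _ hG r sch S₁ hW h8 hC hβ hc n hn
    exact h G hG r sch S₁ hW h8 hC hβ hc n (by omega)
  · intro h G _ _ _ _ _ _ hG r sch S₁ hW h8 hC hβ hc n hn
    rcases Nat.lt_or_ge n 3 with hlt | hge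
    · exact temperedApproximants_of_lt_three hG r sch S₁ hW h8 hC hn hlt
    · exact h G hG r sch S₁ hW h8 hC hβ hc n hge

/-- **T ⟺ order-zero temperedness of `𝔖ₙ|⁰𝒮` in degrees `n ≥ 3`.**  `TemperedCurvatureMoments` BY NAME is
equivalent to: for every admissible `(G, r, sch, S₁)` and every `n ≥ 3` there are `C > 0` and `N` with
`‖F‖ w_{C,N} ∈ L¹` and `‖S₁ n F‖ ≤ ∫ ‖F‖ w_{C,N}` for every `F ∈ ⁰𝒮((ℝ⁴)ⁿ)`,
`w_{C,N}(y) = C (1 + ‖y‖)^N (1 + Σᵢ Σ_{j ≠ i} ‖yᵢ − yⱼ‖⁻¹)^N` — no lattice density, no Riemann sum, `(a_k, L_k)`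
idle (lead c1's `temperedCurvatureMoments_iff_dominated` restricted to the high degrees). [folklore] -/
theorem temperedCurvatureMoments_iff_threeLe_dominated :
    TemperedCurvatureMoments ↔
      ∀ (G : Type) [Group G] [TopologicalSpace G] [IsTopologicalGroup G] [CompactSpace G]
        [MeasurableSpace G] [BorelSpace G], IsCompactSimpleLieGroup G →
        ∀ (r : LatticeRep G) (sch : SpeciesScheme (YMSpecies G)) (S₁ : SchwingerFamily E4),
          W1 r sch S₁ → EightFrameRP S₁ → PlanarCone S₁ → ∀ n : ℕ, 3 ≤ n →
          ∃ (C : ℝ) (N : ℕ), 0 < C ∧ ∀ F : 𝓢((Fin n → E4), ℂ), IsOffDiagonal F →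
            Integrable (fun y => ‖F y‖ * (C * (1 + ‖y‖) ^ N *
              (1 + ∑ i, ∑ j ∈ Finset.univ.erase i, ‖y i - y j‖⁻¹) ^ N)) ∧
            ‖S₁ n F‖ ≤ ∫ y, ‖F y‖ * (C * (1 + ‖y‖) ^ N *
              (1 + ∑ i, ∑ j ∈ Finset.univ.erase i, ‖y i - y j‖⁻¹) ^ N) := by
  rw [temperedCurvatureMoments_iff_threeLe]
  constructor
  · intro h G _ _ _ _ _ _ hG r sch S₁ hW h8 hC n hn
    exact ((temperedApproximants_iff_dominated (by omega) S₁ sch.a_pos sch.tendsto_a sch.tendsto_L).1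
      (h G hG r sch S₁ hW h8 hC n hn)).1
  · intro h G _ _ _ _ _ _ hG r sch S₁ hW h8 hC n hn
    exact (temperedApproximants_iff_dominated (by omega) S₁ sch.a_pos sch.tendsto_a sch.tendsto_L).2
      ⟨h G hG r sch S₁ hW h8 hC n hn, fun f F hF hF' => im_apply_eq_zero_of_tie r sch S₁ hW.1 (by omega) f F hF hF'⟩

end Summit.QuantumFields.YangMills.Theorems.TemperedCurvatureMoments.Sketch

end
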